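import Literature.MathematicalPhysics.QuantumLattice.ExponentialLocalization
import HarnessLib

/-!
# Exponential localization for a diagonal `A`: spectral projections by support, and
# Fröhlich–Lieb's Lemma 3.3 (the number `d` of `B`-steps) in abstract form

Topic `MathematicalPhysics/QuantumLattice`. In every application of Fröhlich–Lieb's Theorem 3.1
(`ExponentialLocalization`) the operator `A` is diagonal in the tensor basis
(`A = S⁻²H^z - e₀(1)`, FL (3.19)), so that `M_ρ` is the span of the basis states of `A`-energy
`≥ ρ`, and hypothesis (iii) — `{B(A-λ)⁻¹}ʲφ ∈ M_ρ` for `j < d` — is verified by COUNTING how much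
one application of `B` can lower the `A`-energy (FL Lemma 3.3: "one application of `H^{xy}` to
a vector `ψ` can raise (resp. lower) the `z`-components of the spins of one nearest neighbor
pair by `1`. Clearly, this cannot change the minimal `A`-energy of `ψ` by more than `8S⁻¹`",
(3.33) `(1 - P_{e-8/S})H^{xy}P_e = 0`). This file provides exactly that, for matrices:

* `IsHermitian.cfc_of_eq_diagonal` — the functional calculus of a real diagonal matrix in ANY
  eigenbasis is the diagonal of the function (so `spectralProjGe`, `resolventGe` of a diagonal
  `A` are the explicit diagonals `spectralProjGe_of_eq_diagonal`, `resolventGe_of_eq_diagonal`);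
* `IsHermitian.spectralProjGe_mulVec_eq_self_iff` — `P_ρ v = v ↔ v` vanishes on the basis
  states of `A`-energy `< ρ`;
* **`mulVec_vanishes_of_lowering`** — FL (3.33): if `B σ τ ≠ 0 ⇒ d τ - c ≤ d σ` ("`B` lowers the
  `A`-energy by at most `c`"), then `B M_e ⊆ M_{e-c}`;
* **`IsHermitian.hypothesisIII_of_lowering`** — FL Lemma 3.3 (2) abstractly: a vector of
  `A`-energy `≥ e` satisfies hypothesis (iii) of Thm. 3.1 with every `d` such that
  `e - (d-1)c ≥ ρ`.

No named facts; no sorries.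

## References

* J. Fröhlich, E. H. Lieb, *Phase transitions in anisotropic lattice spin systems*, Comm. Math.
  Phys. **60** (1978) 233–267, §III.A Thm. 3.1 (iii), eqs. (3.19), (3.24), §III.B Lemma 3.3,
  eqs. (3.30)–(3.33). [FrohlichLieb1978]
-/

noncomputable section

open Matrix Finset
open scoped ComplexOrder MatrixOrder BigOperators

namespace Matrix

variable {n : Type*} [Fintype n] [DecidableEq n]

/-! ### Functional calculus of a diagonal matrix -/

/-- **The functional calculus of a real diagonal matrix is diagonal**, whichever eigenbasis the
spectral theorem chose: `f(diag d) = diag(f ∘ d)`. [cite: FrohlichLieb1978, eq. (3.19)] -/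
theorem IsHermitian.cfc_of_eq_diagonal {A : Matrix n n ℂ} (hA : A.IsHermitian) {d : n → ℝ}
    (hd : A = diagonal fun i => ((d i : ℝ) : ℂ)) (f : ℝ → ℝ) :
    hA.cfc f = diagonal fun i => ((f (d i) : ℝ) : ℂ) := by
  set U : Matrix n n ℂ := (hA.eigenvectorUnitary : Matrix n n ℂ) with hU
  have hUUh : U * Uᴴ = 1 := by
    rw [← star_eq_conjTranspose]; exact Unitary.mul_star_self_of_mem hA.eigenvectorUnitary.prop
  have hUhU : Uᴴ * U = 1 := by
    rw [← star_eq_conjTranspose]; exact Unitary.star_mul_self_of_mem hA.eigenvectorUnitary.prop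
  -- `A U = U diag(λ)`
  have hAU : A * U = U * diagonal (fun j => ((hA.eigenvalues j : ℝ) : ℂ)) := by
    have h := hA.spectral_theorem
    rw [Unitary.conjStarAlgAut_apply, star_eq_conjTranspose] at h
    conv_lhs => rw [h]
    rw [Matrix.mul_assoc, hUhU, Matrix.mul_one]
    rfl
  -- entrywise: `U i j ≠ 0 ⇒ d i = λ j`
  have hent : ∀ i j, U i j ≠ 0 → d i = hA.eigenvalues j := by
    intro i j hij
    have h := congrFun (congrFun hAU i) j
    conv at h => lhs; rw [hd]
    rw [diagonal_mul, mul_diagonal] at h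
    have h0 : (((d i : ℝ) : ℂ) - ((hA.eigenvalues j : ℝ) : ℂ)) * U i j = 0 := by
      rw [sub_mul, h]; ring
    rcases mul_eq_zero.1 h0 with h1 | h1
    · exact_mod_cast sub_eq_zero.1 h1
    · exact absurd h1 hij
  -- hence `diag(f d) U = U diag(f λ)`
  have hfU : diagonal (fun i => ((f (d i) : ℝ) : ℂ)) * U =
      U * diagonal (fun j => ((f (hA.eigenvalues j) : ℝ) : ℂ)) := by
    ext i j
    rw [diagonal_mul, mul_diagonal]
    by_cases hij : U i j = 0
    · rw [hij, mul_zero, zero_mul]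
    · rw [hent i j hij, mul_comm]
  rw [IsHermitian.cfc, Unitary.conjStarAlgAut_apply, star_eq_conjTranspose]
  change U * diagonal (fun j => ((f (hA.eigenvalues j) : ℝ) : ℂ)) * Uᴴ = _
  rw [← hfU, Matrix.mul_assoc, hUUh, Matrix.mul_one]

/-- `P_ρ` of a diagonal `A = diag d` is `diag 𝟙[d ≥ ρ]`.
[cite: FrohlichLieb1978, Thm. 3.1, eq. (3.19)] -/
theorem IsHermitian.spectralProjGe_of_eq_diagonal {A : Matrix n n ℂ} (hA : A.IsHermitian)
    {d : n → ℝ} (hd : A = diagonal fun i => ((d i : ℝ) : ℂ)) (ρ : ℝ) :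
    hA.spectralProjGe ρ = diagonal fun i => if ρ ≤ d i then (1 : ℂ) else 0 := by
  rw [IsHermitian.spectralProjGe, hA.cfc_of_eq_diagonal hd]
  congr 1
  funext i
  split_ifs <;> simp

/-- `(A-λ)⁻¹P_ρ` of a diagonal `A = diag d` is `diag(𝟙[d ≥ ρ]/(d - λ))`.
[cite: FrohlichLieb1978, Thm. 3.1, eq. (3.19)] -/
theorem IsHermitian.resolventGe_of_eq_diagonal {A : Matrix n n ℂ} (hA : A.IsHermitian)
    {d : n → ℝ} (hd : A = diagonal fun i => ((d i : ℝ) : ℂ)) (ρ lam : ℝ) :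
    hA.resolventGe ρ lam =
      diagonal fun i => if ρ ≤ d i then (((d i - lam)⁻¹ : ℝ) : ℂ) else 0 := by
  rw [IsHermitian.resolventGe, hA.cfc_of_eq_diagonal hd]
  congr 1
  funext i
  split_ifs <;> simp

/-! ### `M_ρ` by support -/

/-- **`M_ρ` of a diagonal `A` by support**: `P_ρ v = v` iff `v` vanishes on the basis states of
`A`-energy `< ρ`. [cite: FrohlichLieb1978, Thm. 3.1, eq. (3.33)] -/
theorem IsHermitian.spectralProjGe_mulVec_eq_self_iff {A : Matrix n n ℂ} (hA : A.IsHermitian)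
    {d : n → ℝ} (hd : A = diagonal fun i => ((d i : ℝ) : ℂ)) {ρ : ℝ} {v : n → ℂ} :
    hA.spectralProjGe ρ *ᵥ v = v ↔ ∀ i, d i < ρ → v i = 0 := by
  rw [hA.spectralProjGe_of_eq_diagonal hd]
  constructor
  · intro h i hi
    have h1 := congrFun h i
    rw [mulVec_diagonal, if_neg (not_le.2 hi), zero_mul] at h1
    exact h1.symm
  · intro h
    funext i
    rw [mulVec_diagonal]
    split_ifs with hi
    · exact one_mul _
    · rw [h i (not_le.1 hi), mul_zero]

/-- The restricted resolvent of a diagonal `A` does not enlarge supports.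
[cite: FrohlichLieb1978, Thm. 3.1, eq. (3.33)] -/
theorem IsHermitian.resolventGe_mulVec_vanishes {A : Matrix n n ℂ} (hA : A.IsHermitian)
    {d : n → ℝ} (hd : A = diagonal fun i => ((d i : ℝ) : ℂ)) (ρ lam : ℝ) {e : ℝ} {v : n → ℂ}
    (hv : ∀ i, d i < e → v i = 0) : ∀ i, d i < e → (hA.resolventGe ρ lam *ᵥ v) i = 0 := by
  intro i hi
  rw [hA.resolventGe_of_eq_diagonal hd, mulVec_diagonal, hv i hi, mul_zero]

omit [DecidableEq n] in
/-- **FL (3.33): an operator lowering the `A`-energy by at most `c` maps `M_e` into `M_{e-c}`.**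
If `B σ τ ≠ 0` only when `d τ - c ≤ d σ`, and `v` vanishes below `A`-energy `e`, then `Bv`
vanishes below `e - c`. [cite: FrohlichLieb1978, Lemma 3.3 (1), eqs. (3.32)–(3.33)] -/
theorem mulVec_vanishes_of_lowering {B : Matrix n n ℂ} {d : n → ℝ} {c : ℝ}
    (hB : ∀ σ τ, B σ τ ≠ 0 → d τ - c ≤ d σ) {e : ℝ} {v : n → ℂ} (hv : ∀ i, d i < e → v i = 0) :
    ∀ i, d i < e - c → (B *ᵥ v) i = 0 := by
  intro i hi
  rw [mulVec, dotProduct]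
  refine sum_eq_zero fun τ _ => ?_
  by_cases hτ : d τ < e
  · rw [hv τ hτ, mul_zero]
  · have h0 : B i τ = 0 := by
      by_contra hne
      have := hB i τ hne
      linarith [not_lt.1 hτ]
    rw [h0, zero_mul]

/-- Iterating: `{B(A-λ)⁻¹}ʲ φ` vanishes below `A`-energy `e - jc` when `φ` vanishes below `e`.
[cite: FrohlichLieb1978, Lemma 3.3, eq. (3.33)] -/
theorem IsHermitian.pow_mulVec_vanishes_of_lowering {A B : Matrix n n ℂ} (hA : A.IsHermitian)
    {d : n → ℝ} (hd : A = diagonal fun i => ((d i : ℝ) : ℂ)) {c : ℝ}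
    (hB : ∀ σ τ, B σ τ ≠ 0 → d τ - c ≤ d σ) (ρ lam : ℝ) {e : ℝ} {φ : n → ℂ}
    (hφ : ∀ i, d i < e → φ i = 0) (j : ℕ) :
    ∀ i, d i < e - j * c → ((B * hA.resolventGe ρ lam) ^ j *ᵥ φ) i = 0 := by
  induction j with
  | zero =>
    intro i hi
    rw [pow_zero, one_mulVec]
    exact hφ i (by simpa using hi)
  | succ j ih =>
    intro i hi
    rw [pow_succ' (B * hA.resolventGe ρ lam) j, ← mulVec_mulVec, ← mulVec_mulVec]
    refine mulVec_vanishes_of_lowering hB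
      (hA.resolventGe_mulVec_vanishes hd ρ lam (e := e - j * c) ih) i ?_
    push_cast at hi ⊢
    linarith

/-- **FL Lemma 3.3 (2), abstract form: the number of steps `d`.** For a diagonal `A = diag d`
and `B` lowering the `A`-energy by at most `c ≥ 0` per application, a vector `φ` of `A`-energy
`≥ e` satisfies hypothesis (iii) of Theorem 3.1 — `P_ρ {B(A-λ)⁻¹}ʲφ = {B(A-λ)⁻¹}ʲφ` for all
`j < d` — as soon as `e - (d - 1)c ≥ ρ` (FL: `d ≥ [(ℰ^z(P_Λ) - ρ)/8S⁻¹]`, (3.30)–(3.33)).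
[cite: FrohlichLieb1978, Lemma 3.3 (2), eqs. (3.30)–(3.33)] -/
theorem IsHermitian.hypothesisIII_of_lowering {A B : Matrix n n ℂ} (hA : A.IsHermitian)
    {d : n → ℝ} (hd : A = diagonal fun i => ((d i : ℝ) : ℂ)) {c : ℝ} (hc : 0 ≤ c)
    (hB : ∀ σ τ, B σ τ ≠ 0 → d τ - c ≤ d σ) {ρ lam e : ℝ} {φ : n → ℂ}
    (hφ : ∀ i, d i < e → φ i = 0) {m : ℕ} (hm : ρ ≤ e - ((m - 1 : ℕ) : ℝ) * c) :
    ∀ j < m, hA.spectralProjGe ρ *ᵥ ((B * hA.resolventGe ρ lam) ^ j *ᵥ φ) =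
      (B * hA.resolventGe ρ lam) ^ j *ᵥ φ := by
  intro j hj
  rw [hA.spectralProjGe_mulVec_eq_self_iff hd]
  intro i hi
  refine hA.pow_mulVec_vanishes_of_lowering hd hB ρ lam hφ j i (lt_of_lt_of_le hi (hm.trans ?_))
  have hjm : (j : ℝ) ≤ ((m - 1 : ℕ) : ℝ) := by exact_mod_cast Nat.le_sub_one_of_lt hj
  nlinarith

end Matrix

end
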